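import Mathlib.AlgebraicTopology.FundamentalGroupoid.FundamentalGroup
import Mathlib.Algebra.MvPolynomial.PDeriv
import Mathlib.Topology.Algebra.MvPolynomial
import Mathlib.Analysis.SpecialFunctions.Complex.Circle
import Mathlib.GroupTheory.Subgroup.Simple
import Mathlib.RingTheory.Polynomial.UniqueFactorization
import HarnessLib

/-!
# The fundamental group of the complement of an affine hypersurface is generated by the
# conjugates of one meridian per irreducible component (Zariski–van Kampen; named facts)

Topic `Literature/AlgebraicGeometry/FundamentalGroup`. Written by the literature-typing seat
`littype-FH1-2` (cell `hodge-nonav`) for the route `HodgeConjecture/SignSymmetricPowers`, crux K1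
(`VeryGeneralSignCommutatorsInHg`, registered stub `stub_signPencilEnvelope`; memo STUB-PLAN-SPE-g21
§3.6 "F-ZvK — generation by meridians"): the monodromy group of a family over the complement
`U = ℂᴺ ∖ Δ` of a (reducible) discriminant hypersurface `Δ = Δ₁ ∪ ⋯ ∪ Δₘ` is generated by the
local monodromies of ONE small loop around each irreducible component `Δⱼ` together with their
conjugates, because `π₁(U, s)` itself is the normal closure of such loops. The sister file
`HodgeTheory/LefschetzMonodromy` holds Zariski's theorem in its pencil form
(`zariski_pi1_lineCompl_surjective`, Voisin II Thm. 3.22) and the conjugacy of the vanishing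
cycles of a Lefschetz pencil (Cor. 3.24); the present file records the two statements about the
LOOPS themselves, for an arbitrary finite set of irreducible components, on the plain topological
carrier `ι → ℂ` (so that any parameter space identified with an open subset of an affine space —
e.g. the complex points of an open subscheme of `Spec ℂ[a₁, …, a_N]` through the tree's
`Motives.AlgPoints.isHomeomorph_affinePoint` — can use it).

## Sources, verbatim

* I. Shimada, *Generalized Zariski–van Kampen theorem and its application to Grassmannian dual
  varieties*, Int. J. Math. 21 (2010) 591–637 [Shimada2010ZvK], §3 (arXiv text 0906.1074, held as
  `paper:arxiv-0906.1074`, p. 9). Definition: for a reduced hypersurface `H` of a complex manifold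
  `M` with irreducible components `H₁, …, H_l` and a base point `b_M ∈ M ∖ H`, "A continuous map
  `δ : Δ̄ → M` is called a transversal disc around `Hᵢ` if `δ⁻¹(H) = {0}`, `δ(0) ∈ Hᵢ` and `δ`
  intersects `H` transversely at `0`. […] A leashed disc around `Hᵢ` with the base point `b_M` is a
  pair `ρ = (δ, η)` of a transversal disc `δ` around `Hᵢ` and a path `η : I → M ∖ H` from `δ(1)` to
  `b_M`. […] The lasso `λ(ρ)` associated with a leashed disc `ρ = (δ, η)` is the loop
  `η⁻¹ · (∂δ) · η` in `M ∖ H` with the base point `b_M`." **Proposition 3.4.** "Any two transversal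
  discs around `Hᵢ` with the same sign are isotopic. The homotopy classes of lassos associated with
  all the leashed discs around `Hᵢ` with a fixed sign form a conjugacy class in `π₁(M ∖ H, b_M)`.
  The kernel of the homomorphism `π₁(M ∖ H, b_M) → π₁(M, b_M)` induced by the inclusion is
  generated by the homotopy classes of all lassos around `H₁, …, H_l`."
* P. Deligne, *La conjecture de Weil. I*, Publ. Math. IHÉS 43 (1974) [Deligne1974], (5.2) (p. 290):
  "choisissons des lacets disjoints `(γ_s)_{s ∈ S}` partant de `u`, avec `γ_s` tournant une fois
  autour de `s` […] Ces lacets engendrent le groupe fondamental `π₁(U, u)`"; proof of Thm. (5.4)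
  (p. 291): "Pour `x` dans le lieu lisse de codimension `1` de `X̌`, soient `ch` un chemin de `t` à
  `x` dans `P̌ − X̌`, et `γ_x` le lacet qui suit `ch` jusqu'au voisinage de `X̌`, tourne une fois
  autour de `X̌`, puis revient à `t` par `ch`. Les lacets `γ_x` (pour `ch` variable) sont conjugués
  entre eux. Puisque `X̌` est irréductible, deux points du lieu lisse de `X̌` peuvent toujours, dans
  `X̌`, être joints par un chemin qui ne quitte pas le lieu lisse. Il en résulte que la classe de
  conjugaison de `γ_x` ne dépend pas de `x`."
* C. Voisin, *Hodge Theory and Complex Algebraic Geometry II* (2003) [VoisinHodgeII2003], Thm. 3.22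
  (Zariski: `π₁(Δ − Δ ∩ 𝒴, 0) → π₁(U, 0)` is onto for a line `Δ` through `0` meeting `𝒴`
  transversally in its smooth locus), Fig. 3.2 ("The loops `γ̃ᵢ` generate `π₁(ℙ¹ − {0₁, …, 0_M}, 0)`")
  and the proof of Prop. 3.23 (the same transport-along-the-smooth-locus argument as Deligne's);
  J. Carlson, D. Toledo, Duke Math. J. 97 (1999) §3 [CarlsonToledo1999]: "`S` is either
  `ℂ^{N+1} − {0}`, `N ≥ 1` or `ℙᴺ`, so that `S` is simply connected and hence that `π₁(S − Δ)` is
  generated by meridians […] When the discriminant locus is irreducible the argument of Zariski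
  [Zar] or [DeWeOne], paragraph preceding Corollary 5.5, shows that the meridians of `π₁(S − Δ)` are
  mutually conjugate"; A. Dimca, *Singularities and Topology of Hypersurfaces* (1992) [Dimca1992],
  Ch. 4 (3.1) and (2.15)–(2.16) (the same for `ℙⁿ ∖ V`).

## Rendering

The ambient manifold is `M = ℂ^ι` (`ι` a finite type; simply connected, so Shimada's kernel is
the whole group), the hypersurface is `H = V(h₁) ∪ ⋯ ∪ V(hₘ)` for IRREDUCIBLE polynomials
`hⱼ ∈ ℂ[xᵢ : i ∈ ι]` (its irreducible components are the distinct `V(hⱼ)`; listing a component twice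
is harmless, see below), and `U = affineHypersurfaceComplement h = {z | ∀ j, hⱼ(z) ≠ 0}`.
A **meridian** of the component `V(hⱼ)` based at `s ∈ U` (`Meridian h s j`) is Shimada's lasso of a
leashed disc, SPECIALISED to straight holomorphic discs (never stronger: these are particular
transversal discs of sign `+1`): a point `y` with `hⱼ(y) = 0` and `hᵢ(y) ≠ 0` for `i ≠ j`, a
direction `v` with `Σ_k ∂_k hⱼ(y) v_k ≠ 0` (so `y` is a smooth point of `H` and the disc
`c ↦ y + c v` meets `H` transversally at `c = 0`), a radius `ε > 0` such that the punctured closed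
disc `{y + c v | 0 < |c| ≤ ε}` lies in `U` (`δ⁻¹(H) = {0}`), and a leash: a path in `U` from `s` to
`y + ε v`. Its class `Meridian.loopClass ∈ π₁(U, s)` (Mathlib `FundamentalGroup`) is leash · circle
`θ ↦ y + ε e^{2πiθ} v` · leash⁻¹. If `hᵢ` and `hⱼ` cut out the same component for some `i ≠ j`,
or `V(hⱼ) = ∅`, then `Meridian h s j` is empty and the facts below say nothing.

NAMED FACTS (two printed statements; `Prop`-valued definitions):
* `affineHypersurfaceComplement_meridians_normalClosure_eq_top` — Shimada Prop. 3.4 (third and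
  second sentences) for `M = ℂ^ι`: for ANY choice of one meridian `μⱼ` per component, the normal
  closure of `{μ₁, …, μₘ}` is `π₁(U, s)` (the kernel of `π₁(U) → π₁(ℂ^ι) = 1` is generated by all
  lassos of both signs; those of sign `+1` around `V(hⱼ)` are conjugate to `μⱼ`, those of sign `−1`
  to `μⱼ⁻¹`).
* `affineHypersurfaceComplement_meridian_isConj` — Shimada Prop. 3.4 (second sentence) / Deligne's
  argument: two meridians of the same component are conjugate in `π₁(U, s)`.
PROVED: unfolding lemmas, `Meridian.leashEnd_mem` is forced by the disc condition, and the
consumer shape `MonoidHom.range_eq_closure_conj_of_normalClosure_eq_top`: under any representation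
`ρ : π₁(U, s) →* G` (e.g. a monodromy representation), the image of `π₁` is generated by the
`ρ(π₁)`-conjugates of the `ρ(μⱼ)` — "the monodromy group is generated by the conjugates of the
local monodromies of the meridians".

Not here: the projective version (`ℙᴺ ∖ V`, Dimca (4.3.1); it follows from the affine one on the cone
`ℂ^{N+1} ∖ {0}`), general complex manifolds `M` (no complex-manifold carrier is fixed in the tree
for this purpose), presentations / relations of `π₁` (the Zariski–van Kampen theorem proper, Dimca
(4.3.15)), and the identification of the complex points of an open subscheme of affine space with an
open subset of `ι → ℂ` (tree: `Motives.AlgPoints.isHomeomorph_affinePoint`,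
`Motives.AlgPoints.isEmbedding_map` for open immersions).

## References

* [Shimada2010ZvK] I. Shimada, Generalized Zariski–van Kampen theorem and its application to
  Grassmannian dual varieties, Int. J. Math. 21 (2010) 591–637, §3 Prop. 3.4 (arXiv 0906.1074 p. 9).
* [Deligne1974] P. Deligne, La conjecture de Weil. I, Publ. Math. IHÉS 43 (1974), (5.2) and proof of
  Thm. (5.4), pp. 290–291.
* [VoisinHodgeII2003] C. Voisin, Hodge Theory and Complex Algebraic Geometry II, CUP 2003, §3.2.2
  Thm. 3.22, Prop. 3.23 (proof), Fig. 3.2.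
* [CarlsonToledo1999] J. A. Carlson, D. Toledo, Discriminant complements and kernels of monodromy
  representations, Duke Math. J. 97 (1999), §3.
* [Dimca1992] A. Dimca, Singularities and Topology of Hypersurfaces, Springer 1992, Ch. 4 (2.15),
  (2.16), (3.1).
-/

noncomputable section

open scoped unitInterval
open Complex

namespace Literature.AlgebraicGeometry.FundamentalGroup

variable {ι : Type} {m : ℕ}

/-! ### The complement of an affine hypersurface with listed components -/

/-- The complement `U = ℂ^ι ∖ (V(h₁) ∪ ⋯ ∪ V(hₘ)) = {z | hⱼ(z) ≠ 0 for all j}` of the affine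
hypersurface with (listed) components `V(hⱼ)`, as a subset of `ι → ℂ` (Shimada's `M ∖ H` for
`M = ℂ^ι`, `H = V(h₁ ⋯ hₘ)`). [cite: Shimada2010ZvK, §3 (before Prop. 3.4)] -/
def affineHypersurfaceComplement (h : Fin m → MvPolynomial ι ℂ) : Set (ι → ℂ) :=
  {z | ∀ j, MvPolynomial.eval z (h j) ≠ 0}

/-- Membership in the complement: all the `hⱼ` are non-zero at `z`. [cite: Shimada2010ZvK, §3] -/
@[simp]
theorem mem_affineHypersurfaceComplement_iff (h : Fin m → MvPolynomial ι ℂ) (z : ι → ℂ) :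
    z ∈ affineHypersurfaceComplement h ↔ ∀ j, MvPolynomial.eval z (h j) ≠ 0 :=
  Iff.rfl

/-- The complement is an open subset of `ℂ^ι` (each `hⱼ` is continuous): Shimada's `M ∖ H` is an
open submanifold. [cite: Shimada2010ZvK, §3 (before Prop. 3.4)] -/
theorem isOpen_affineHypersurfaceComplement [Fintype ι] (h : Fin m → MvPolynomial ι ℂ) :
    IsOpen (affineHypersurfaceComplement h) := by
  have : affineHypersurfaceComplement h = ⋂ j, {z | MvPolynomial.eval z (h j) ≠ 0} := by
    ext z; simp [affineHypersurfaceComplement]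
  rw [this]
  exact isOpen_iInter_of_finite fun j ↦
    isOpen_ne_fun (MvPolynomial.continuous_eval (h j)) continuous_const

/-! ### Meridians (lassos of straight holomorphic discs) -/

/-- The point `y + c • v` of the straight disc through `y` in the direction `v` (a transversal disc
`δ(c) = y + c v` in Shimada's sense once `v` is transversal). [cite: Shimada2010ZvK, §3 Definition before Prop. 3.4] -/
def discPoint (y v : ι → ℂ) (c : ℂ) : ι → ℂ := y + c • v

/-- The centre of the disc is `δ(0) = y`. [cite: Shimada2010ZvK, §3 Definition before Prop. 3.4] -/
@[simp]
theorem discPoint_zero (y v : ι → ℂ) : discPoint y v 0 = y := by simp [discPoint]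

/-- A **meridian** (lasso of a leashed straight disc) of the component `V(hⱼ)` of
`H = ⋃ᵢ V(hᵢ) ⊂ ℂ^ι`, based at `s ∈ U = ℂ^ι ∖ H`: a centre `y ∈ V(hⱼ)` off the other components, a
direction `v` transversal to `V(hⱼ)` at `y` (`dhⱼ(y) · v ≠ 0`, so `y` is a smooth point of `H`), a
radius `ε > 0` with the punctured closed disc `{y + c v | 0 < |c| ≤ ε}` inside `U`, and a leash —
a path in `U` from the base point `s` to the boundary point `y + ε v`. Shimada's "leashed disc
`ρ = (δ, η)`" with `δ(c) = y + ε c v` (a transversal disc of sign `+1`) and `η` the reversed leash.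
[cite: Shimada2010ZvK, §3 Definition before Prop. 3.4 (arXiv 0906.1074 p. 9)] -/
structure Meridian [Fintype ι] (h : Fin m → MvPolynomial ι ℂ)
    (s : affineHypersurfaceComplement h) (j : Fin m) where
  /-- The centre of the disc: a point of `V(hⱼ)`. -/
  y : ι → ℂ
  /-- The direction of the disc. -/
  v : ι → ℂ
  /-- The radius of the disc. -/
  ε : ℝ
  ε_pos : 0 < ε
  /-- `y` lies on the component `V(hⱼ)`. -/
  eval_center : MvPolynomial.eval y (h j) = 0
  /-- `y` lies on no other listed component. -/
  eval_center_ne : ∀ i, i ≠ j → MvPolynomial.eval y (h i) ≠ 0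
  /-- The disc is transversal to `V(hⱼ)` at `y`: `d/dc hⱼ(y + c v)|_{c=0} = Σ_k ∂_k hⱼ(y) v_k ≠ 0`. -/
  transversal : ∑ k, MvPolynomial.eval y (MvPolynomial.pderiv k (h j)) * v k ≠ 0
  /-- The punctured closed disc of radius `ε` lies in `U` (`δ⁻¹(H) = {0}`). -/
  discPoint_mem : ∀ c : ℂ, c ≠ 0 → ‖c‖ ≤ ε → discPoint y v c ∈ affineHypersurfaceComplement h
  /-- The boundary point `y + ε v` lies in `U` (forced by `discPoint_mem`, `Meridian.leashEnd_mem'`;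
  recorded as a field so that the type of `leash` is a closed term). -/
  leashEnd_mem : discPoint y v (ε : ℂ) ∈ affineHypersurfaceComplement h
  /-- The leash: a path in `U` from the base point to the boundary point `y + ε v` of the disc. -/
  leash : Path s ⟨discPoint y v (ε : ℂ), leashEnd_mem⟩

namespace Meridian

variable [Fintype ι] {h : Fin m → MvPolynomial ι ℂ} {s : affineHypersurfaceComplement h}
  {j : Fin m} (μ : Meridian h s j)

/-- The field `leashEnd_mem` is forced: `y + ε v` is a point of the punctured closed disc
(`δ(1) ∈ M ∖ H`). [cite: Shimada2010ZvK, §3 Definition before Prop. 3.4] -/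
theorem leashEnd_mem' : discPoint μ.y μ.v (μ.ε : ℂ) ∈ affineHypersurfaceComplement h :=
  μ.discPoint_mem _ (by exact_mod_cast μ.ε_pos.ne') (by simp [abs_of_pos μ.ε_pos])

/-- The boundary point `δ(1) = y + ε v` of the disc, as a point of `U` (the start of Shimada's path
`η`). [cite: Shimada2010ZvK, §3 Definition before Prop. 3.4] -/
def leashEnd : affineHypersurfaceComplement h := ⟨discPoint μ.y μ.v (μ.ε : ℂ), μ.leashEnd_mem⟩

/-- `leashEnd` is the point `y + ε v`. [cite: Shimada2010ZvK, §3 Definition before Prop. 3.4] -/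
@[simp]
theorem coe_leashEnd : (μ.leashEnd : ι → ℂ) = discPoint μ.y μ.v (μ.ε : ℂ) := rfl

/-- The point `∂δ(θ) = y + ε e^{2πiθ} v` of the boundary circle of the disc, `θ ∈ [0, 1]` ("`∂δ` is the
loop given by `t ↦ δ(exp(2π√−1 t))`"). [cite: Shimada2010ZvK, §3 Definition before Prop. 3.4] -/
def circlePoint (θ : I) : ι → ℂ :=
  discPoint μ.y μ.v ((μ.ε : ℂ) * Complex.exp (2 * Real.pi * Complex.I * ((θ : ℝ) : ℂ)))

/-- The boundary circle lies in `U` (the punctured closed disc does). [cite: Shimada2010ZvK, §3 Definition before Prop. 3.4] -/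
theorem circlePoint_mem (θ : I) : μ.circlePoint θ ∈ affineHypersurfaceComplement h := by
  refine μ.discPoint_mem _ (mul_ne_zero (by exact_mod_cast μ.ε_pos.ne') (Complex.exp_ne_zero _)) ?_
  rw [norm_mul, Complex.norm_exp]
  have hre : (2 * (Real.pi : ℂ) * Complex.I * ((θ : ℝ) : ℂ)).re = 0 := by
    simp [Complex.mul_re]
  rw [hre, Real.exp_zero, mul_one]
  simp [abs_of_pos μ.ε_pos]

/-- `∂δ(0) = y + ε v`. [cite: Shimada2010ZvK, §3 Definition before Prop. 3.4] -/
@[simp]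
theorem circlePoint_zero : μ.circlePoint 0 = discPoint μ.y μ.v (μ.ε : ℂ) := by
  simp [circlePoint]

/-- `∂δ(1) = y + ε v` (`e^{2πi} = 1`). [cite: Shimada2010ZvK, §3 Definition before Prop. 3.4] -/
@[simp]
theorem circlePoint_one : μ.circlePoint 1 = discPoint μ.y μ.v (μ.ε : ℂ) := by
  simp [circlePoint]

/-- The boundary circle `θ ↦ y + ε e^{2πiθ} v` of the disc (Shimada's `∂δ`), a loop in `U` at
`y + ε v`. [cite: Shimada2010ZvK, §3 Definition before Prop. 3.4] -/
def circle : Path μ.leashEnd μ.leashEnd where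
  toFun θ := ⟨μ.circlePoint θ, μ.circlePoint_mem θ⟩
  continuous_toFun := by
    refine Continuous.subtype_mk ?_ _
    unfold circlePoint discPoint
    fun_prop
  source' := Subtype.ext (by simp)
  target' := Subtype.ext (by simp)

/-- The boundary circle on points. [cite: Shimada2010ZvK, §3 Definition before Prop. 3.4] -/
@[simp]
theorem coe_circle_apply (θ : I) : ((μ.circle θ : affineHypersurfaceComplement h) : ι → ℂ) =
    μ.circlePoint θ := rfl

/-- The meridian loop leash · circle · leash⁻¹ at the base point `s`. [cite: Shimada2010ZvK, §3 Definition before Prop. 3.4] -/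
def loop : Path s s := (μ.leash.trans μ.circle).trans μ.leash.symm

/-- **The class of the meridian in `π₁(U, s)`** — Shimada's lasso `λ(ρ)` (up to the orientation
conventions of path composition, which do not affect conjugacy classes, normal closures or
inverses-closed generating sets). [cite: Shimada2010ZvK, §3 Definition before Prop. 3.4] -/
def loopClass : FundamentalGroup (affineHypersurfaceComplement h) s :=
  FundamentalGroup.fromPath ⟦μ.loop⟧

/-- Unfolding `loopClass`. [cite: Shimada2010ZvK, §3 Definition before Prop. 3.4] -/
theorem loopClass_def : μ.loopClass = FundamentalGroup.fromPath ⟦μ.loop⟧ := rfl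

end Meridian

/-! ### The named facts -/

/-- **The fundamental group of the complement of an affine hypersurface is the normal closure of
one meridian per irreducible component** (Zariski–van Kampen; Shimada 2010, Prop. 3.4 for
`M = ℂ^ι`, which is simply connected). Let `h₁, …, hₘ ∈ ℂ[xᵢ : i ∈ ι]` be irreducible, `U = {z |
hⱼ(z) ≠ 0 ∀ j}`, `s ∈ U`, and let `μⱼ` be a meridian of `V(hⱼ)` based at `s` for every `j` (any
centres, directions, radii and leashes). Then the smallest normal subgroup of `π₁(U, s)` containing
`μ₁, …, μₘ` is `π₁(U, s)`: printed, "The homotopy classes of lassos associated with all the leashed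
discs around `Hᵢ` with a fixed sign form a conjugacy class in `π₁(M ∖ H, b_M)`. The kernel of the
homomorphism `π₁(M ∖ H, b_M) → π₁(M, b_M)` induced by the inclusion is generated by the homotopy
classes of all lassos around `H₁, …, H_l`" (lassos of sign `−1` are inverses of lassos of sign `+1`);
Deligne: "Ces lacets engendrent le groupe fondamental `π₁(U, u)`"; Carlson–Toledo: "`S` is simply
connected and hence `π₁(S − Δ)` is generated by meridians".
[cite: Shimada2010ZvK, §3 Prop. 3.4 (arXiv 0906.1074 p. 9)]
[cite: Deligne1974, (5.2) and proof of Thm. (5.4), pp. 290–291]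
[cite: VoisinHodgeII2003, §3.2.2 Thm. 3.22 and Fig. 3.2] -/
def affineHypersurfaceComplement_meridians_normalClosure_eq_top : Prop :=
  ∀ (ι : Type) [Fintype ι] (m : ℕ) (h : Fin m → MvPolynomial ι ℂ), (∀ j, Irreducible (h j)) →
    ∀ (s : affineHypersurfaceComplement h) (μ : ∀ j, Meridian h s j),
      Subgroup.normalClosure (Set.range fun j ↦ (μ j).loopClass) = ⊤

/-- **Meridians of the same irreducible component are conjugate** (Shimada 2010, Prop. 3.4, second
sentence; Zariski's argument as in Deligne, Weil I, proof of (5.4): "Les lacets `γ_x` (pour `ch`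
variable) sont conjugués entre eux. Puisque `X̌` est irréductible, deux points du lieu lisse de `X̌`
peuvent toujours, dans `X̌`, être joints par un chemin qui ne quitte pas le lieu lisse. Il en résulte
que la classe de conjugaison de `γ_x` ne dépend pas de `x`"). For irreducible `h₁, …, hₘ`, `s ∈ U`
and two meridians `μ, μ'` of the same component `V(hⱼ)` based at `s` (both of sign `+1`, being
boundaries of holomorphic discs), `μ` and `μ'` are conjugate in `π₁(U, s)`.
[cite: Shimada2010ZvK, §3 Prop. 3.4 (arXiv 0906.1074 p. 9)]
[cite: Deligne1974, proof of Thm. (5.4), p. 291] -/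
def affineHypersurfaceComplement_meridian_isConj : Prop :=
  ∀ (ι : Type) [Fintype ι] (m : ℕ) (h : Fin m → MvPolynomial ι ℂ), (∀ j, Irreducible (h j)) →
    ∀ (s : affineHypersurfaceComplement h) (j : Fin m) (μ μ' : Meridian h s j),
      IsConj μ.loopClass μ'.loopClass

/-! ### Consumer shapes (proved) -/

/-- **Group theory of "generated by conjugates of the local monodromies"**: if the normal closure of
`S` is the whole group `π` and `ρ : π →* G` is any homomorphism (a monodromy representation), then
the image of `ρ` is generated by the `ρ(π)`-conjugates of `ρ(S)` (the group theory behind "the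
monodromy group is generated by the local monodromies of the lassos and their conjugates").
[cite: Shimada2010ZvK, §3 Prop. 3.4 (group-theoretic form)] -/
theorem _root_.MonoidHom.range_eq_closure_conj_of_normalClosure_eq_top {π G : Type*} [Group π]
    [Group G] (ρ : π →* G) {S : Set π} (hS : Subgroup.normalClosure S = ⊤) :
    ρ.range = Subgroup.closure {x | ∃ g ∈ ρ.range, ∃ t ∈ S, x = g * ρ t * g⁻¹} := by
  apply le_antisymm
  · rintro _ ⟨p, rfl⟩
    have hp : p ∈ Subgroup.normalClosure S := by rw [hS]; exact Subgroup.mem_top p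
    rw [Subgroup.normalClosure] at hp
    induction hp using Subgroup.closure_induction with
    | mem x hx =>
      obtain ⟨t, ht, c, hc⟩ := Group.mem_conjugatesOfSet_iff.mp hx
      have hx' : x = (c : π) * t * (c : π)⁻¹ := by
        rw [hc.eq, mul_assoc, mul_inv_cancel, mul_one]
      refine Subgroup.subset_closure ⟨ρ c, ⟨(c : π), rfl⟩, t, ht, ?_⟩
      rw [hx', map_mul, map_mul, map_inv]
    | one => rw [map_one]; exact Subgroup.one_mem _
    | mul x y _ _ hx hy => rw [map_mul]; exact Subgroup.mul_mem _ hx hy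
    | inv x _ hx => rw [map_inv]; exact Subgroup.inv_mem _ hx
  · refine (Subgroup.closure_le _).mpr ?_
    rintro _ ⟨g, ⟨q, rfl⟩, t, -, rfl⟩
    exact ⟨q * t * q⁻¹, by simp [map_mul, map_inv]⟩

/-- Pointwise form: under `normalClosure S = ⊤`, every `ρ(p)` lies in the subgroup generated by the
`ρ(π)`-conjugates of `ρ(S)`. [cite: Shimada2010ZvK, §3 Prop. 3.4 (group-theoretic form)] -/
theorem _root_.MonoidHom.apply_mem_closure_conj_of_normalClosure_eq_top {π G : Type*} [Group π]
    [Group G] (ρ : π →* G) {S : Set π} (hS : Subgroup.normalClosure S = ⊤) (p : π) :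
    ρ p ∈ Subgroup.closure {x | ∃ g ∈ ρ.range, ∃ t ∈ S, x = g * ρ t * g⁻¹} := by
  rw [← ρ.range_eq_closure_conj_of_normalClosure_eq_top hS]
  exact ⟨p, rfl⟩

/-- **Consumer form of the first fact**: for a monodromy representation `ρ : π₁(U, s) →* G` of the
complement of `V(h₁) ∪ ⋯ ∪ V(hₘ)` (irreducible `hⱼ`) and one meridian `μⱼ` per component, the image
of `ρ` — the monodromy group — is generated by the conjugates (inside the monodromy group) of the
local monodromies `ρ(μⱼ)`. [cite: Shimada2010ZvK, §3 Prop. 3.4] [cite: CarlsonToledo1999, §3] -/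
theorem affineHypersurfaceComplement_meridians_normalClosure_eq_top.range_eq_closure
    (H : affineHypersurfaceComplement_meridians_normalClosure_eq_top) {ι : Type} [Fintype ι] {m : ℕ}
    {h : Fin m → MvPolynomial ι ℂ} (hirr : ∀ j, Irreducible (h j))
    {s : affineHypersurfaceComplement h} (μ : ∀ j, Meridian h s j) {G : Type*} [Group G]
    (ρ : FundamentalGroup (affineHypersurfaceComplement h) s →* G) :
    ρ.range = Subgroup.closure
      {x | ∃ g ∈ ρ.range, ∃ j, x = g * ρ (μ j).loopClass * g⁻¹} := by
  have hset : {x | ∃ g ∈ ρ.range, ∃ t ∈ Set.range (fun j ↦ (μ j).loopClass), x = g * ρ t * g⁻¹} =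
      {x | ∃ g ∈ ρ.range, ∃ j, x = g * ρ (μ j).loopClass * g⁻¹} := by
    ext x
    simp only [Set.mem_setOf_eq, Set.mem_range, exists_exists_eq_and]
  have h1 := ρ.range_eq_closure_conj_of_normalClosure_eq_top (H ι m h hirr s μ)
  rw [hset] at h1
  exact h1

/-- A class invariant under (the images of) all the meridians is invariant under the whole
fundamental group: if `ρ(μⱼ) = 1` for all `j` then `ρ = 1` (first fact, homomorphism form).
[cite: Shimada2010ZvK, §3 Prop. 3.4] -/
theorem affineHypersurfaceComplement_meridians_normalClosure_eq_top.eq_one_of_forall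
    (H : affineHypersurfaceComplement_meridians_normalClosure_eq_top) {ι : Type} [Fintype ι] {m : ℕ}
    {h : Fin m → MvPolynomial ι ℂ} (hirr : ∀ j, Irreducible (h j))
    {s : affineHypersurfaceComplement h} (μ : ∀ j, Meridian h s j) {G : Type*} [Group G]
    (ρ : FundamentalGroup (affineHypersurfaceComplement h) s →* G)
    (hρ : ∀ j, ρ (μ j).loopClass = 1) (p : FundamentalGroup (affineHypersurfaceComplement h) s) :
    ρ p = 1 := by
  have hle : Subgroup.normalClosure (Set.range fun j ↦ (μ j).loopClass) ≤ ρ.ker :=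
    Subgroup.normalClosure_le_normal (by rintro _ ⟨j, rfl⟩; exact hρ j)
  rw [H ι m h hirr s μ, top_le_iff] at hle
  have : p ∈ ρ.ker := by rw [hle]; exact Subgroup.mem_top p
  exact this

/-- **Consumer form of the second fact**: the local monodromies of two meridians of the same
component are conjugate in the monodromy group. [cite: Shimada2010ZvK, §3 Prop. 3.4] [cite: Deligne1974, proof of Thm. (5.4), p. 291] -/
theorem affineHypersurfaceComplement_meridian_isConj.map
    (H : affineHypersurfaceComplement_meridian_isConj) {ι : Type} [Fintype ι] {m : ℕ}
    {h : Fin m → MvPolynomial ι ℂ} (hirr : ∀ j, Irreducible (h j))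
    {s : affineHypersurfaceComplement h} {j : Fin m} (μ μ' : Meridian h s j) {G : Type*} [Group G]
    (ρ : FundamentalGroup (affineHypersurfaceComplement h) s →* G) :
    ∃ g ∈ ρ.range, ρ μ'.loopClass = g * ρ μ.loopClass * g⁻¹ := by
  obtain ⟨c, hc⟩ := H ι m h hirr s j μ μ'
  have h' : μ'.loopClass = (c : FundamentalGroup (affineHypersurfaceComplement h) s) * μ.loopClass *
      (c : FundamentalGroup (affineHypersurfaceComplement h) s)⁻¹ := by
    rw [hc.eq, mul_assoc, mul_inv_cancel, mul_one]
  refine ⟨ρ c, ⟨_, rfl⟩, ?_⟩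
  rw [h', map_mul, map_mul, map_inv]

end Literature.AlgebraicGeometry.FundamentalGroup

end
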